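import Summits.QuantumFields.YangMills.Theorems.SwapVirialDeficitBlowUpGnomonicTipRotTransverse
import HarnessLib

/-!
# The aligned frame: letters after rotating the longer leader onto the hub axis

Sub-problem `SwapVirialDeficit`, crux ⟨stmt-QuantumFields-24197⟩ `SwapGluedStiffness`, skeleton ➎, stub `stub_core_tip`, socket (hCore); letters for file F4/F5 of
w2 g61's aligned-rotation assembly (HOME memo `w2-g61-memo-hCore-S3S4-aligned.md` §1–§2, LEAD g100 (B8)).  For `x ≠ 0` and a unit `u` with
`rot3 u e₀ = x/|x|` (✓`exists_rot3_e0_eq`):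
* ★ `rot3_star_self_axis` — `rot3 ū x = (|x|, 0, 0)` EXACTLY;
* ★ `rot3_star_other_axial` — `(rot3 ū y)₀ = ⟨x,y⟩/|x|`;
* ★ `rot3_star_other_transverse_sq` — `(rot3 ū y)₁² + (rot3 ū y)₂² = |x × y|²/|x|²` (Lagrange), the input of the cross floor ✓`gnoDeficit_floor_cross`;
(✓`rot3_star_apply_zero`, ✓`transverse_sq_rot3_star`, ✓`normSq3_rot3`).

HONEST LABEL: letter bookkeeping only; (hCore), `stub_core_tip`, ⟨24197⟩, ⟨24194⟩ remain OPEN; nothing here proves the Yang–Mills mass gap.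
-/

noncomputable section

open Quaternion Set
open scoped Quaternion BigOperators
open Literature.MathematicalPhysics.QuantumLattice
open Literature.MathematicalPhysics.QuantumFieldTheory hiding SU2

namespace Summit.QuantumFields.YangMills.Theorems.SwapVirialDeficit.BlowUpRing

open Summit.QuantumFields.YangMills.Theorems.FemtoTransferGap
open Summit.QuantumFields.YangMills.Theorems.FemtoTransferGap.TT
open Summit.QuantumFields.YangMills.Theorems.SwapVirialDeficit.Gnomonic (normSq3)

variable {L : ℕ}

/-- ★ **THE ALIGNED LEADER IS EXACTLY AXIAL**: if `rot3 u e₀ = x/|x|` then `rot3 ū x = (|x|, 0, 0)`. [folklore] -/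
theorem rot3_star_self_axis {u : ℍ} (hu : ‖u‖ = 1) {x : Fin 3 → ℝ} (hx : 0 < normSq3 x)
    (hrot : rot3 u ![1, 0, 0] = (Real.sqrt (normSq3 x))⁻¹ • x) :
    rot3 (star u) x = ![Real.sqrt (normSq3 x), 0, 0] := by
  have hN : x 0 ^ 2 + x 1 ^ 2 + x 2 ^ 2 = normSq3 x := (normSq3_eq_three' x).symm
  set r : ℝ := Real.sqrt (normSq3 x) with hrdef
  have hr : 0 < r := Real.sqrt_pos.2 hx
  have hr2 : r ^ 2 = normSq3 x := Real.sq_sqrt hx.le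
  have hdot : ∑ i, rot3 u ![1, 0, 0] i * x i = r := by
    rw [hrot, Fin.sum_univ_three]
    simp only [Pi.smul_apply, smul_eq_mul]
    have e : r⁻¹ * x 0 * x 0 + r⁻¹ * x 1 * x 1 + r⁻¹ * x 2 * x 2 = r⁻¹ * (x 0 ^ 2 + x 1 ^ 2 + x 2 ^ 2) := by ring
    rw [e, hN, ← hr2, sq, ← mul_assoc, inv_mul_cancel₀ hr.ne', one_mul]
  have h0 : rot3 (star u) x 0 = r := by rw [rot3_star_apply_zero hu, hdot]
  have htr : (rot3 (star u) x 1) ^ 2 + (rot3 (star u) x 2) ^ 2 = 0 := by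
    rw [transverse_sq_rot3_star hu, hdot, hr2, sub_self]
  have h1 : rot3 (star u) x 1 = 0 := by nlinarith [sq_nonneg (rot3 (star u) x 1), sq_nonneg (rot3 (star u) x 2)]
  have h2 : rot3 (star u) x 2 = 0 := by nlinarith [sq_nonneg (rot3 (star u) x 1), sq_nonneg (rot3 (star u) x 2)]
  ext i
  fin_cases i
  · simpa using h0
  · simpa using h1
  · simpa using h2

/-- ★ **THE OTHER LEADER'S AXIAL LETTER**: `(rot3 ū y)₀ = ⟨x,y⟩/|x|`. [folklore] -/
theorem rot3_star_other_axial {u : ℍ} (hu : ‖u‖ = 1) {x : Fin 3 → ℝ} (hrot : rot3 u ![1, 0, 0] = (Real.sqrt (normSq3 x))⁻¹ • x) (y : Fin 3 → ℝ) :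
    rot3 (star u) y 0 = (Real.sqrt (normSq3 x))⁻¹ * (x 0 * y 0 + x 1 * y 1 + x 2 * y 2) := by
  rw [rot3_star_apply_zero hu, hrot, Fin.sum_univ_three]
  simp only [Pi.smul_apply, smul_eq_mul]
  ring

/-- ★ **THE OTHER LEADER'S TRANSVERSE SIZE** (Lagrange): `(rot3 ū y)₁² + (rot3 ū y)₂² = |x × y|²/|x|²` for `x ≠ 0`. [folklore] -/
theorem rot3_star_other_transverse_sq {u : ℍ} (hu : ‖u‖ = 1) {x : Fin 3 → ℝ} (hx : 0 < normSq3 x)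
    (hrot : rot3 u ![1, 0, 0] = (Real.sqrt (normSq3 x))⁻¹ • x) (y : Fin 3 → ℝ) :
    (rot3 (star u) y 1) ^ 2 + (rot3 (star u) y 2) ^ 2 =
      ((x 1 * y 2 - x 2 * y 1) ^ 2 + (x 2 * y 0 - x 0 * y 2) ^ 2 + (x 0 * y 1 - x 1 * y 0) ^ 2) / normSq3 x := by
  have hN : x 0 ^ 2 + x 1 ^ 2 + x 2 ^ 2 = normSq3 x := (normSq3_eq_three' x).symm
  set r : ℝ := Real.sqrt (normSq3 x) with hrdef
  have hr : 0 < r := Real.sqrt_pos.2 hx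
  have hr2 : r ^ 2 = normSq3 x := Real.sq_sqrt hx.le
  have hρN : r⁻¹ ^ 2 * normSq3 x = 1 := by rw [← hr2, inv_pow, inv_mul_cancel₀ (pow_ne_zero 2 hr.ne')]
  rw [transverse_sq_rot3_star hu, ← rot3_star_apply_zero hu, rot3_star_other_axial hu hrot, eq_div_iff hx.ne', normSq3_eq_three' y]
  set N : ℝ := normSq3 x with hNdef
  set d : ℝ := x 0 * y 0 + x 1 * y 1 + x 2 * y 2 with hd
  calc (y 0 ^ 2 + y 1 ^ 2 + y 2 ^ 2 - (r⁻¹ * d) ^ 2) * N = (y 0 ^ 2 + y 1 ^ 2 + y 2 ^ 2) * N - d ^ 2 * (r⁻¹ ^ 2 * N) := by ring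
    _ = (y 0 ^ 2 + y 1 ^ 2 + y 2 ^ 2) * (x 0 ^ 2 + x 1 ^ 2 + x 2 ^ 2) - d ^ 2 := by rw [hρN, mul_one, hN]
    _ = (x 1 * y 2 - x 2 * y 1) ^ 2 + (x 2 * y 0 - x 0 * y 2) ^ 2 + (x 0 * y 1 - x 1 * y 0) ^ 2 := by rw [hd]; ring

end Summit.QuantumFields.YangMills.Theorems.SwapVirialDeficit.BlowUpRing

end
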